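import Literature.NumberTheory.EllipticCurves.ModularCurve
import Literature.NumberTheory.EllipticCurves.QuadraticTwist
import Literature.NumberTheory.EllipticCurves.Isogeny
import Literature.NumberTheory.EllipticCurves.GlobalMinimalModel
import Literature.NumberTheory.DiophantineGeometry.Conductor
import HarnessLib
import HarnessLib.Audit.Tags

/-!
# Candidates S-an-7 / E-an-5 (theorem targets) and E-an-6 (conjecture): the `√−3`-CHAIN and the HERMITIAN
# TWIST TRICHOTOMY at `3` (`SqrtMinusThreeChain`, `HermitianTwistTrichotomyAtThree`,
# `SmallDiscriminantCarriesSqrtMinusThree`)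
# — cell `bsd-f2-manin` (D-0131 (3) frontier: the Manin constant at additive primes). `@[conjecture]`
# leaf (NOTHING asserted; definitions only; proved dictionary edge in `CuspUnipotentEdges.lean`).

HONEST FRAMING. LENS = analytic / period-lattice (planner `bsd-f2-manin-an` g1, HOME
`run/shared/lean/pub/bsd-f2-manin/MEMO-an.md` PART II §§13–17), Props VERBATIM from HOME/an/Sketch-an2.lean
(sha16 592a983c0c28c202; audited copy HOME/ref1-C8-an-g1.lean) with its abbreviations inlined:
`IsLatticeOptimal D` = the lattice clause `Λ_W = c·Λ_f`; `sqrtMinusThree = (Real.sqrt 3 : ℂ) * Complex.I`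
(`√−3 = g(χ₋₃) = ζ₃ − ζ₃²`); `LatticeInSqrtMinusThree f g` = «`Λ_f ⊆ √−3 · Λ_g`» =
`∀ z ∈ periodLattice f, ∃ w ∈ periodLattice g, z = √−3 * w` (the ORIENTATION clause `i(f, g) = 1`).
MECHANISM (memo §13): for `9 ∣ N`, `f + 2 f|τ_3 = √−3 · (f ⊗ χ₋₃)` with `τ_3` in the normaliser of `Γ₀(N)`,
so for a `−3`-twist pair at the same conductor `3Λ_f ⊆ √−3 Λ_{f′} ⊆ Λ_f` (index `i(f) ∈ {1, 3, 9}`,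
`i(f)·i(f′) = 9`; the tree's `gaussSum_mul_mem_periodLattice_of_mem_charTwist` twice).

THE ROWS. S-an-7 `SqrtMinusThreeChain` (support, THEOREM TARGET): the two inclusions. E-an-5
`HermitianTwistTrichotomyAtThree` (THEOREM TARGET; the decider of the imc trichotomy at `p = 3`): `27 ∣ N`,
`(W, D)`, `(W′, D′)` lattice-optimal at the same conductor, `W′ ~ W ⊗ χ₋₃`, classes distinct: (a) the twist
of the optimal curve is optimal iff `Λ_f = √−3Λ_{f′}` or `Λ_{f′} = √−3Λ_f`; (b) `Λ_f = √−3 Λ_{f′} ⇒ deg′ = 3·deg`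
and symmetrically; (c) otherwise `deg′ = deg` and there is a rational isogeny `W ⊗ χ₋₃ → W′` of degree `3`.
E-an-6 `SmallDiscriminantCarriesSqrtMinusThree` (CONJECTURE ⟺ `ord₃ c(W) = ord₃ c(W′)` on commuting
`−3`-twist pairs given E-an-5 and the covolume dictionary): on a commuting pair the member with the SMALLER
`v₃(Δ_min)` is the one whose lattice is `√−3` times the other's. BC5 WITNESS (memo §§14–16, HOME/an/g1-*,
N < 5·10⁵): E-an-5: 182 372 commuting classes with ratio `3^{±1}` (0 exceptions), 15 076 non-commuting with
ratio 1 and `ψ₀ = 3` (0 exceptions); E-an-6 consequence `ratio 3 ⟺ dv₃Δ = +6` in 91 186 / 91 186. Refuter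
verdicts: REF1 **E-an-5 (+S-an-7) SURVIVES, E-an-6 SURVIVES** 2026-08-27T16:22Z (HOME/REFUTER-ref1.md §R4:
rc 0, BC7 CLEAN; independent engines: 27 ∣ N commute 182 372 / flip 15 076 / 0 violations, and the same
trichotomy holds on `9 ∥ N` (107 970 + 6 698, 0 violations) — «you may weaken `3³ ∣ N` to `3² ∣ N ∧ N′ = N`»;
`sqrtMinusThree² = −3` read back); REF2 (HOME/REFUTER-ref2.md, v3 §C″): E-an-5 SPLIT — (T-a) chain + (T-d)
ratio IN-PRINT-IMPLICIT (Edixhoven 1991 §4 / Stevens 1989 (5.4); index-free via `τ₃ ∈ Norm`), (T-b)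
rigidity + (T-c) flip decider NOT-IN-PRINT (Edixhoven 1991 asserts proportionality, false in general — no
source characterises the fourth case) ⇒ beyond-print theorem candidate; E-an-6 NOT-IN-PRINT / OPEN-NEW
(conjecture-strength; = the cell's E-imc-6 sign / E-imc-2 at `(3, χ₋₃)` on commuting pairs; implied by Manin's
conjecture).
-/

noncomputable section

open scoped MatrixGroups ModularForm

open CongruenceSubgroup WeierstrassCurve
  Literature.NumberTheory.EllipticCurves Literature.NumberTheory.EllipticCurves.ModularForms

namespace Summit.BirchSwinnertonDyer.Rank1Residual.ManinAdditive

/-- **S-an-7 `SqrtMinusThreeChain` (cell bsd-f2-manin; support THEOREM TARGET — statement-to-prove from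
in-tree ingredients, nothing asserted):** for optimal data of a `−3`-twist pair at the same conductor with
`9 ∣ N`: `√−3 Λ_{f′} ⊆ Λ_f` and `√−3 Λ_f ⊆ Λ_{f′}`.
[cite: Stevens1989, Lemma (5.4) p. 97 (the Gauss-sum inclusion for twisted period lattices; the two-sided chain
for optimal data at 9 ∣ N is NOT stated in print — cell bsd-f2-manin MEMO-an.md §13, S-an-7)] -/
@[conjecture] def SqrtMinusThreeChain : Prop :=
  ∀ (W W' : WeierstrassCurve ℚ) [W.IsElliptic] [W.IsGloballyMinimal] [W'.IsElliptic]
    [W'.IsGloballyMinimal] [NeZero (W.conductorNorm ℤ)] [NeZero (W'.conductorNorm ℤ)]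
    (D : ModularParametrizationData W (W.conductorNorm ℤ))
    (D' : ModularParametrizationData W' (W'.conductorNorm ℤ)),
    3 ^ 2 ∣ W.conductorNorm ℤ → W'.conductorNorm ℤ = W.conductorNorm ℤ →
    IsIsogenous (W.quadraticTwist ((-3 : ℤ) : ℚ)) W' →
    (∀ w ∈ periodLattice D'.f, ((Real.sqrt 3 : ℂ) * Complex.I) * w ∈ periodLattice D.f) ∧
    (∀ z ∈ periodLattice D.f, ((Real.sqrt 3 : ℂ) * Complex.I) * z ∈ periodLattice D'.f)

/-- **E-an-5 `HermitianTwistTrichotomyAtThree` (cell bsd-f2-manin; THEOREM TARGET — (a)/(d) in print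
implicitly, (b)/(c) not; nothing asserted):** `27 ∣ N`, `(W, D)`, `(W′, D′)` lattice-optimal at the same
conductor, `W′ ~ W ⊗ χ₋₃`, classes distinct: (a) `W′ ≅_ℚ W ⊗ χ₋₃` iff `Λ_f ⊆ √−3Λ_{f′}` or `Λ_{f′} ⊆ √−3Λ_f`;
(b) `Λ_f ⊆ √−3 Λ_{f′} ⇒ deg φ_{D′} = 3·deg φ_D`; `Λ_{f′} ⊆ √−3 Λ_f ⇒ deg φ_D = 3·deg φ_{D′}`; (c) otherwise
`deg φ_{D′} = deg φ_D` and there is a rational isogeny `W ⊗ χ₋₃ → W′` of degree `3`.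
[cite: Stevens1989, Lemma (5.4) p. 97 (shape of the lattice comparison; the trichotomy for OPTIMAL curves is NOT
in print — cell bsd-f2-manin MEMO-an.md §14, E-an-5)] -/
@[conjecture] def HermitianTwistTrichotomyAtThree : Prop :=
  ∀ (W W' : WeierstrassCurve ℚ) [W.IsElliptic] [W.IsGloballyMinimal] [W'.IsElliptic]
    [W'.IsGloballyMinimal] [NeZero (W.conductorNorm ℤ)] [NeZero (W'.conductorNorm ℤ)]
    (D : ModularParametrizationData W (W.conductorNorm ℤ))
    (D' : ModularParametrizationData W' (W'.conductorNorm ℤ)),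
    (∀ z ∈ D.L.lattice, ∃ w ∈ periodLattice D.f, z = D.c * w) →
    (∀ z ∈ D'.L.lattice, ∃ w ∈ periodLattice D'.f, z = D'.c * w) →
    3 ^ 3 ∣ W.conductorNorm ℤ → W'.conductorNorm ℤ = W.conductorNorm ℤ →
    IsIsogenous (W.quadraticTwist ((-3 : ℤ) : ℚ)) W' →
    ¬ IsIsogenous W W' →
    ((∃ C : VariableChange ℚ, C • W.quadraticTwist ((-3 : ℤ) : ℚ) = W') ↔
        ((∀ z ∈ periodLattice D.f, ∃ w ∈ periodLattice D'.f, z = ((Real.sqrt 3 : ℂ) * Complex.I) * w) ∨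
          (∀ z ∈ periodLattice D'.f, ∃ w ∈ periodLattice D.f, z = ((Real.sqrt 3 : ℂ) * Complex.I) * w))) ∧
    ((∀ z ∈ periodLattice D.f, ∃ w ∈ periodLattice D'.f, z = ((Real.sqrt 3 : ℂ) * Complex.I) * w) →
        D'.modularDegree = 3 * D.modularDegree) ∧
    ((∀ z ∈ periodLattice D'.f, ∃ w ∈ periodLattice D.f, z = ((Real.sqrt 3 : ℂ) * Complex.I) * w) →
        D.modularDegree = 3 * D'.modularDegree) ∧
    ((¬ ∃ C : VariableChange ℚ, C • W.quadraticTwist ((-3 : ℤ) : ℚ) = W') →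
        D'.modularDegree = D.modularDegree ∧
        ∃ φ : Isogeny (W.quadraticTwist ((-3 : ℤ) : ℚ)) W', φ.degree = 3)

/-- **Candidate E-an-6 `SmallDiscriminantCarriesSqrtMinusThree` (cell bsd-f2-manin; a CONJECTURE, NOT in
print, nothing asserted):** on a commuting `−3`-twist pair (`W′ = C • (W ⊗ χ₋₃)`, `27 ∣ N`, both data
lattice-optimal at the same conductor) with `v₃Δ_min(W′) = v₃Δ_min(W) + 6`, the small-discriminant member's
lattice is `√−3` times the other's: `Λ_f ⊆ √−3 · Λ_{f′}`.
[cite: Stevens1989, Lemma (5.4) p. 97 (shape only; the orientation law is NOT in print — cell bsd-f2-manin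
MEMO-an.md §16, E-an-6)] -/
@[conjecture] def SmallDiscriminantCarriesSqrtMinusThree : Prop :=
  ∀ (W W' : WeierstrassCurve ℚ) [W.IsElliptic] [W.IsGloballyMinimal] [W'.IsElliptic]
    [W'.IsGloballyMinimal] [NeZero (W.conductorNorm ℤ)] [NeZero (W'.conductorNorm ℤ)]
    (D : ModularParametrizationData W (W.conductorNorm ℤ))
    (D' : ModularParametrizationData W' (W'.conductorNorm ℤ)) (C : VariableChange ℚ),
    (∀ z ∈ D.L.lattice, ∃ w ∈ periodLattice D.f, z = D.c * w) →
    (∀ z ∈ D'.L.lattice, ∃ w ∈ periodLattice D'.f, z = D'.c * w) →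
    3 ^ 3 ∣ W.conductorNorm ℤ → W'.conductorNorm ℤ = W.conductorNorm ℤ →
    C • W.quadraticTwist ((-3 : ℤ) : ℚ) = W' →
    padicValInt 3 W'.minimalDiscriminantInt = padicValInt 3 W.minimalDiscriminantInt + 6 →
    ∀ z ∈ periodLattice D.f, ∃ w ∈ periodLattice D'.f, z = ((Real.sqrt 3 : ℂ) * Complex.I) * w

end Summit.BirchSwinnertonDyer.Rank1Residual.ManinAdditive

end
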